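import Summits.QuantumFields.YangMills.Theorems.LuscherReductionTwistedTraceScalingBODefectPieceRates
import Summits.QuantumFields.YangMills.Theorems.LuscherReductionTwistedTraceScalingBOCentralRatesFour
import Summits.QuantumFields.YangMills.Theorems.LuscherReductionTwistedTraceScalingToronZeroMode
import Summits.QuantumFields.YangMills.Theorems.LuscherReductionTwistedTraceScalingSlowDisintegrationTubes
import HarnessLib

/-!
# (C4-CORE γ-rates, outer piece) THE OUTER-REGION PIECE OVER THE CURRENCY FLOOR IS `o(λ_bare)`
# (lane A of S-BASE, crux `TwistedTraceScaling` stmt-QuantumFields-20203, C4-CORE, the (OD) pen; `pub/ym-fleet/ym-luscher-20007-p1/HANDOFF-g20.md` (γ))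

The coefficient of `∫φ²` in `…BODefectOutPiece.out_sq_integral_le_of_sep` at the record data (`N̄ = fpWeightBar(β^{-1})`, `κ_P = C_p(43β^{-s})²`, `R₀ = r_F/12`, `τ = β^{-1}ℓ`,
`K_sep = e^{2β|E|}e^{−β(r_F/1000)²}`) is `X_O(β) = 3·π(univ)·c_g·e^{4β|E|}·(e^{−β·gap·(r_F/24)²} + e^{−2ℓ²} + e^{−ℓ²} + e^{−β(r_F/1000)²})`; with `β r_F² = ℓ²`
(`…BODefectPieceRates.eventually_beta_mul_rf_sq`) every bracket term is `≤ e^{−qℓ²}`, `q = min(gap/576, 10⁻⁶)`, and `c_g = 1/(N̄(1−κ_P)) ≤ 2/N̄ ≤ (2/c₀)·β^{flatDim}`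
(`…BOCentralRatesFour.fpWeightBar_ge`).  ★★ `out_rate_small` — `∀ a > 0, ∀ᶠ β, X_O(β)/(c_R·β^{-K}·e^{4β|E|}) ≤ a·bareLambda(L³β)` (`…BODefectPieceRates.piece_rate_small`).
HONEST FRAMING: bookkeeping for a stub of a child of the CONDITIONAL route R2b1; the hOD assembly, (B-ST), C4-CORE remain OPEN; not a gap, not Clay.
-/

set_option autoImplicit false

noncomputable section

open MeasureTheory Filter Topology Real
open Literature.MathematicalPhysics.QuantumFieldTheory
open Literature.MathematicalPhysics.QuantumLattice

namespace Summit.QuantumFields.YangMills.Theorems.FemtoTransferGap.TwoLattice.ConstTube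

open Summit.QuantumFields.YangMills.Theorems.FemtoTransferGap
open Summit.QuantumFields.YangMills.Theorems.FemtoTransferGap.TwoLattice
open Summit.QuantumFields.YangMills.Theorems.FemtoTransferGap.TwoLattice.Toron (gap_pos)

variable {L : ℕ} [NeZero L]

/-- `1/N̄(β^{-1}) ≤ (√G·(2π²)^n)·(β^{-1})^{-flatDim}`, i.e. `0 ≤ 1/N̄ ≤ P/(β^{-1})^{flatDim}` with `P = √(gramDet 0)/((2π²)^{-1})^n`. [folklore] -/
theorem inv_fpWeightBar_le (β : ℝ) :
    1 / fpWeightBar L (powScale 1 β) ≤ (Real.sqrt (gramDet L 0) / ((2 * π ^ 2)⁻¹) ^ Fintype.card (NzSite L)) / powScale 1 β ^ flatDim L := by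
  have hps : 0 < powScale 1 β := powScale_pos 1 β
  have hG : 0 < Real.sqrt (gramDet L 0) := Real.sqrt_pos.mpr (gramDet_zero_pos L)
  have hc : 0 < ((2 * π ^ 2)⁻¹ : ℝ) ^ Fintype.card (NzSite L) := by positivity
  have hN := fpWeightBar_ge (L := L) hps
  have hN0 : 0 < ((2 * π ^ 2)⁻¹ : ℝ) ^ Fintype.card (NzSite L) * powScale 1 β ^ flatDim L / Real.sqrt (gramDet L 0) := by positivity
  calc 1 / fpWeightBar L (powScale 1 β) ≤ 1 / (((2 * π ^ 2)⁻¹ : ℝ) ^ Fintype.card (NzSite L) * powScale 1 β ^ flatDim L / Real.sqrt (gramDet L 0)) :=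
        one_div_le_one_div_of_le hN0 hN
    _ = (Real.sqrt (gramDet L 0) / ((2 * π ^ 2)⁻¹) ^ Fintype.card (NzSite L)) / powScale 1 β ^ flatDim L := by
        field_simp

set_option maxHeartbeats 800000 in
-- explicit record expressions.
/-- ★★ **THE OUTER PIECE IS `o(λ_bare)` OVER THE CURRENCY FLOOR** (see the module docstring). [cite: Luscher1983, §3] -/
theorem out_rate_small (hL : 2 ≤ L) {s : ℝ} (hs : 0 < s) (Cp : ℝ) {cR : ℝ} (hcR : 0 < cR) (K : ℕ) :
    ∀ a : ℝ, 0 < a → ∀ᶠ β : ℝ in atTop,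
      (3 * ((orthoTransverse L Set.univ).toReal * (1 / (fpWeightBar L (powScale 1 β) * (1 - Cp * (43 * powScale s β) ^ 2))) *
        ((Real.exp (2 * β) ^ Fintype.card (Edge 3 L)) ^ 2 * (Real.exp (-(β * (2 - 2 * Real.cos (2 * Real.pi / L)) * ((min (1 / 40) (powScale (1 / 2) β * btLog β)) / 12 / 2) ^ 2)) +
            Real.exp (-(((powScale 1 β) * btLog β) ^ 2 / powScale 1 β ^ 2)) ^ 2 + Real.exp (-(((powScale 1 β) * btLog β) ^ 2 / powScale 1 β ^ 2))) +
          Real.exp (2 * β) ^ Fintype.card (Edge 3 L) * (Real.exp (2 * β) ^ Fintype.card (Edge 3 L) * Real.exp (-(β * ((min (1 / 40) (powScale (1 / 2) β * btLog β)) / 1000) ^ 2)))))) /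
        (cR * powScale 1 β ^ K * (Real.exp (2 * β) ^ Fintype.card (Edge 3 L)) ^ 2) ≤ a * bareLambda ((L : ℝ) ^ 3 * β) := by
  haveI := isFiniteMeasure_orthoTransverse L
  set gap : ℝ := 2 - 2 * Real.cos (2 * Real.pi / L) with hgap
  have hgap0 : 0 < gap := gap_pos L hL
  set q : ℝ := min (gap / 576) (1 / 1000000) with hqdef
  have hq0 : 0 < q := lt_min (by positivity) (by norm_num)
  have hq1 : q ≤ gap / 576 := min_le_left _ _
  have hq2 : q ≤ 1 / 1000000 := min_le_right _ _
  set Pm : ℝ := (orthoTransverse L Set.univ).toReal with hPm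
  have hPm0 : 0 ≤ Pm := ENNReal.toReal_nonneg
  set c₀i : ℝ := Real.sqrt (gramDet L 0) / ((2 * π ^ 2)⁻¹) ^ Fintype.card (NzSite L) with hc₀i
  have hc₀i0 : 0 ≤ c₀i := by rw [hc₀i]; positivity
  -- `Q β = 3·π(univ)·c_g·4`
  set Q : ℝ → ℝ := fun β => 3 * (Pm * (1 / (fpWeightBar L (powScale 1 β) * (1 - Cp * (43 * powScale s β) ^ 2)))) * 4 with hQ
  have hκ : ∀ᶠ β : ℝ in atTop, Cp * (43 * powScale s β) ^ 2 ≤ 1 / 2 := by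
    have h := ((tendsto_powScale hs).const_mul 43).pow 2 |>.const_mul Cp
    rw [mul_zero, zero_pow two_ne_zero, mul_zero] at h
    exact h.eventually (eventually_le_nhds (by norm_num))
  refine piece_rate_small (L := L) hq0 (P := 3 * (Pm * (2 * c₀i)) * 4) (by positivity) hcR (flatDim L) K (Q := Q) ?_ ?_
  · -- `X_O ≤ EK²·Q·e^{−qℓ²}`
    filter_upwards [eventually_beta_mul_rf_sq, hκ, eventually_ge_atTop (1 : ℝ)] with β hrf hκβ hβ1
    set EK : ℝ := Real.exp (2 * β) ^ Fintype.card (Edge 3 L) with hEK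
    have hEK0 : 0 < EK := by positivity
    have hN : 0 < fpWeightBar L (powScale 1 β) := fpWeightBar_pos L (powScale_pos 1 β)
    have hcg0 : 0 ≤ 1 / (fpWeightBar L (powScale 1 β) * (1 - Cp * (43 * powScale s β) ^ 2)) := by
      apply div_nonneg zero_le_one; apply mul_nonneg hN.le; linarith
    have hℓ : 0 ≤ btLog β ^ 2 := sq_nonneg _
    have hps : 0 < powScale 1 β := powScale_pos 1 β
    -- the four exponentials
    have e1 : Real.exp (-(β * gap * ((min (1 / 40) (powScale (1 / 2) β * btLog β)) / 12 / 2) ^ 2)) ≤ Real.exp (-(q * btLog β ^ 2)) := by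
      rw [Real.exp_le_exp, neg_le_neg_iff]
      have : β * gap * ((min (1 / 40) (powScale (1 / 2) β * btLog β)) / 12 / 2) ^ 2 = gap / 576 * (β * (min (1 / 40) (powScale (1 / 2) β * btLog β)) ^ 2) := by ring
      rw [this, hrf]
      exact mul_le_mul_of_nonneg_right hq1 hℓ
    have eτ : ((powScale 1 β) * btLog β) ^ 2 / powScale 1 β ^ 2 = btLog β ^ 2 := by field_simp
    have e2 : Real.exp (-(((powScale 1 β) * btLog β) ^ 2 / powScale 1 β ^ 2)) ≤ Real.exp (-(q * btLog β ^ 2)) := by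
      rw [eτ, Real.exp_le_exp, neg_le_neg_iff]; nlinarith
    have e2' : Real.exp (-(((powScale 1 β) * btLog β) ^ 2 / powScale 1 β ^ 2)) ^ 2 ≤ Real.exp (-(q * btLog β ^ 2)) := by
      have h0 : 0 ≤ Real.exp (-(((powScale 1 β) * btLog β) ^ 2 / powScale 1 β ^ 2)) := (Real.exp_pos _).le
      have h1 : Real.exp (-(((powScale 1 β) * btLog β) ^ 2 / powScale 1 β ^ 2)) ≤ 1 := Real.exp_le_one_iff.mpr (by rw [eτ]; linarith)
      calc _ ≤ Real.exp (-(((powScale 1 β) * btLog β) ^ 2 / powScale 1 β ^ 2)) * 1 := by rw [pow_two]; exact mul_le_mul_of_nonneg_left h1 h0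
        _ ≤ _ := by rw [mul_one]; exact e2
    have e3 : Real.exp (-(β * ((min (1 / 40) (powScale (1 / 2) β * btLog β)) / 1000) ^ 2)) ≤ Real.exp (-(q * btLog β ^ 2)) := by
      rw [Real.exp_le_exp, neg_le_neg_iff]
      have : β * ((min (1 / 40) (powScale (1 / 2) β * btLog β)) / 1000) ^ 2 = 1 / 1000000 * (β * (min (1 / 40) (powScale (1 / 2) β * btLog β)) ^ 2) := by ring
      rw [this, hrf]
      exact mul_le_mul_of_nonneg_right hq2 hℓ
    set X : ℝ := Real.exp (-(q * btLog β ^ 2)) with hX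
    have hX0 : 0 ≤ X := (Real.exp_pos _).le
    have hsum : EK ^ 2 * (Real.exp (-(β * gap * ((min (1 / 40) (powScale (1 / 2) β * btLog β)) / 12 / 2) ^ 2)) + Real.exp (-(((powScale 1 β) * btLog β) ^ 2 / powScale 1 β ^ 2)) ^ 2 +
          Real.exp (-(((powScale 1 β) * btLog β) ^ 2 / powScale 1 β ^ 2))) + EK * (EK * Real.exp (-(β * ((min (1 / 40) (powScale (1 / 2) β * btLog β)) / 1000) ^ 2))) ≤ EK ^ 2 * (4 * X) := by
      have h := add_le_add (add_le_add e1 e2') e2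
      have h4 := mul_le_mul_of_nonneg_left h (sq_nonneg EK)
      have h5 : EK * (EK * Real.exp (-(β * ((min (1 / 40) (powScale (1 / 2) β * btLog β)) / 1000) ^ 2))) ≤ EK ^ 2 * X := by
        rw [← mul_assoc, ← pow_two]; exact mul_le_mul_of_nonneg_left e3 (sq_nonneg EK)
      linarith
    have hA0 : 0 ≤ 3 * (Pm * (1 / (fpWeightBar L (powScale 1 β) * (1 - Cp * (43 * powScale s β) ^ 2)))) := by positivity
    calc _ = 3 * (Pm * (1 / (fpWeightBar L (powScale 1 β) * (1 - Cp * (43 * powScale s β) ^ 2)))) *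
          (EK ^ 2 * (Real.exp (-(β * gap * ((min (1 / 40) (powScale (1 / 2) β * btLog β)) / 12 / 2) ^ 2)) + Real.exp (-(((powScale 1 β) * btLog β) ^ 2 / powScale 1 β ^ 2)) ^ 2 +
            Real.exp (-(((powScale 1 β) * btLog β) ^ 2 / powScale 1 β ^ 2))) + EK * (EK * Real.exp (-(β * ((min (1 / 40) (powScale (1 / 2) β * btLog β)) / 1000) ^ 2)))) := by ring
      _ ≤ 3 * (Pm * (1 / (fpWeightBar L (powScale 1 β) * (1 - Cp * (43 * powScale s β) ^ 2)))) * (EK ^ 2 * (4 * X)) :=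
          mul_le_mul_of_nonneg_left hsum hA0
      _ = EK ^ 2 * Q β * X := by simp only [hQ]; ring
  · -- `0 ≤ Q ≤ P/ps1^{flatDim}`
    filter_upwards [hκ] with β hκβ
    have hN : 0 < fpWeightBar L (powScale 1 β) := fpWeightBar_pos L (powScale_pos 1 β)
    have hps : 0 < powScale 1 β := powScale_pos 1 β
    have h1κ : 1 / 2 ≤ 1 - Cp * (43 * powScale s β) ^ 2 := by linarith
    have hcg0 : 0 ≤ 1 / (fpWeightBar L (powScale 1 β) * (1 - Cp * (43 * powScale s β) ^ 2)) := by positivity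
    have hcg : 1 / (fpWeightBar L (powScale 1 β) * (1 - Cp * (43 * powScale s β) ^ 2)) ≤ 2 * c₀i / powScale 1 β ^ flatDim L := by
      have hi := inv_fpWeightBar_le (L := L) β
      rw [← hc₀i] at hi
      calc 1 / (fpWeightBar L (powScale 1 β) * (1 - Cp * (43 * powScale s β) ^ 2)) ≤ 1 / (fpWeightBar L (powScale 1 β) * (1 / 2)) :=
            one_div_le_one_div_of_le (by positivity) (mul_le_mul_of_nonneg_left h1κ hN.le)
        _ = 2 * (1 / fpWeightBar L (powScale 1 β)) := by field_simp
        _ ≤ 2 * (c₀i / powScale 1 β ^ flatDim L) := by linarith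
        _ = 2 * c₀i / powScale 1 β ^ flatDim L := by ring
    refine ⟨by simp only [hQ]; positivity, ?_⟩
    calc Q β = 3 * (Pm * (1 / (fpWeightBar L (powScale 1 β) * (1 - Cp * (43 * powScale s β) ^ 2)))) * 4 := rfl
      _ ≤ 3 * (Pm * (2 * c₀i / powScale 1 β ^ flatDim L)) * 4 := by gcongr
      _ = 3 * (Pm * (2 * c₀i)) * 4 / powScale 1 β ^ flatDim L := by field_simp

end Summit.QuantumFields.YangMills.Theorems.FemtoTransferGap.TwoLattice.ConstTube

end
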